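import Summits.ResolutionOfSingularities.ResolutionOfSingularities.Theorems.WeightedInvariantWeightedThesisHypersurfaceModelImage
import Literature.AlgebraicGeometry.Resolution.LinearProjectionVertex
import Literature.AlgebraicGeometry.Resolution.ResolutionOfCurves
import Literature.AlgebraicGeometry.Resolution.FiniteBirationalNormal
import Literature.AlgebraicGeometry.Resolution.ChowLemmaProofs
import Literature.AlgebraicGeometry.Motives.ProjectiveNoetherNormalization
import Literature.AlgebraicGeometry.Motives.VarietiesProjectiveSpaceProofs

/-!
# `WeightedInvariant.WeightedThesis`, line `datum-glued-split`, stub 5 (hypersurface models), II: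
# hypersurface models from a finite projection / from linear forms

Second of four files for `stub_hypersurfaceModel` (crux `WeightedThesis`,
stmt-ResolutionOfSingularities-0569). PROVED here:

* `isBirational_of_surjective_stalkMap` — a finite dominant morphism of integral schemes onto a
  variety, surjective on the stalk at the generic point, is birational;
* `hypersurfaceModel_of_projection` — `φ₀ : X → ℙ^{d+1}_k` finite, avoiding the vertex,
  `dim X = d`, surjective on the stalk at `η_X` ⇒ the conclusion of `stub_hypersurfaceModel`
  (`Y = ℙ^{d+1} ∖ {vertex}`, `H` the scheme-theoretic image, locally principal by file I);
* `stub_hypersurfaceModel_of_linearForms` (registered shape) — the same from linear forms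
  `t₀, …, t_{d+1}` (`t₀, …, t_d` without common zero, `t₀ ≢ 0`, `K(X) = k(t_a/t₀)`), ANY field.
[Hartshorne I Prop. 4.9; Kollár 2007, proof of Prop. 2.48; Stacks 0AB1]
-/

noncomputable section

set_option linter.dupNamespace false -- mandated namespace of this single-conjunct summit

open CategoryTheory CategoryTheory.Limits AlgebraicGeometry TopologicalSpace Topology
  HomogeneousLocalization
open Literature.AlgebraicGeometry.Resolution Literature.AlgebraicGeometry.Motives
open Literature.AlgebraicGeometry.Motives.Segre (grading cst frac chartι toSpec X_mem pull pull_comp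
  pull_SpecMap')

attribute [local instance] MvPolynomial.gradedAlgebra

namespace Summit.ResolutionOfSingularities.ResolutionOfSingularities.Theorems.WeightedThesis.HypersurfaceModel

universe u

/-! # Part A: finite + isomorphism of function fields ⇒ birational -/

/-- Over a non-empty affine open `V` of the integral `Y` WITH INTEGRALLY CLOSED COORDINATE RING, an
integral dominant morphism from an integral scheme whose stalk map at the generic point is an
isomorphism restricts to an isomorphism: `A = Γ(Y, V) → B = Γ(X, f⁻¹V)` is injective and
integral, and `K(X) = Frac A` through it, so every element of `B` comes from `A`
(the tree's `isIso_morphismRestrict_of_isIntegralHom_of_isIso_stalkMap` with the normality of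
all local rings weakened to that of the one ring `Γ(Y, V)`). [folklore] -/
theorem isIso_morphismRestrict_of_isIntegrallyClosed {X Y : Scheme.{u}}
    [IsIntegral X] [IsIntegral Y] (f : X ⟶ Y) [IsIntegralHom f] [IsDominant f]
    (hstalk : IsIso (f.stalkMap (genericPoint X))) {V : Y.Opens} (hV : IsAffineOpen V)
    (hVne : (V : Set Y).Nonempty) (hic : IsIntegrallyClosed Γ(Y, V)) : IsIso (f ∣_ V) := by
  -- adapted from Literature/AlgebraicGeometry/Resolution/FiniteBirationalNormal.lean
  haveI : IsSchemeTheoreticallyDominant f := .of_isDominant f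
  haveI := hstalk
  have hfη : f (genericPoint X) = genericPoint Y := genericPoint_eq_of_isDominant f
  have hηV : genericPoint Y ∈ V :=
    ((genericPoint_spec Y).mem_open_set_iff V.isOpen).mpr
      (by obtain ⟨y, hy⟩ := hVne; exact ⟨y, Set.mem_univ _, hy⟩)
  have hξV : genericPoint X ∈ f ⁻¹ᵁ V := by
    show f (genericPoint X) ∈ V
    rw [hfη]
    exact hηV
  haveI : Nonempty ↥(f ⁻¹ᵁ V) := ⟨⟨_, hξV⟩⟩
  haveI : Nonempty ((f ⁻¹ᵁ V : X.Opens) : Scheme.{u}) := ⟨⟨_, hξV⟩⟩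
  haveI : Nonempty ↥V := ⟨⟨_, hηV⟩⟩
  haveI : Nonempty (V : Scheme.{u}) := ⟨⟨_, hηV⟩⟩
  -- `A = Γ(Y, V) → B = Γ(X, f⁻¹ V) → K(X)`
  letI algAB : Algebra Γ(Y, V) Γ(X, f ⁻¹ᵁ V) := (f.app V).hom.toAlgebra
  letI algAK : Algebra Γ(Y, V) X.functionField :=
    ((X.germToFunctionField (f ⁻¹ᵁ V)).hom.comp (f.app V).hom).toAlgebra
  haveI : IsScalarTower Γ(Y, V) Γ(X, f ⁻¹ᵁ V) X.functionField :=
    IsScalarTower.of_algebraMap_eq (R := Γ(Y, V)) (S := Γ(X, f ⁻¹ᵁ V)) (A := X.functionField)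
      fun a => rfl
  -- `K(Y) ≅ K(X)` under `A`
  let e0 : Y.presheaf.stalk (genericPoint Y) ≅ X.functionField :=
    Y.presheaf.stalkCongr (.of_eq hfη.symm) ≪≫ asIso (f.stalkMap (genericPoint X))
  have hsp : f (genericPoint X) ⤳ genericPoint Y := by rw [hfη]
  have he0 : ∀ a : Γ(Y, V), e0.hom (Y.germToFunctionField V a) =
      X.germToFunctionField (f ⁻¹ᵁ V) (f.app V a) := fun a => by
    show (Y.presheaf.germ V (genericPoint Y) hηV ≫
      Y.presheaf.stalkSpecializes hsp ≫ f.stalkMap (genericPoint X)) a =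
        (f.app V ≫ X.presheaf.germ (f ⁻¹ᵁ V) (genericPoint X) hξV) a
    rw [TopCat.Presheaf.germ_stalkSpecializes_assoc, Scheme.Hom.germ_stalkMap]
  let eA : Y.functionField ≃ₐ[Γ(Y, V)] X.functionField :=
    { e0.commRingCatIsoToRingEquiv with
      commutes' := fun a => he0 a }
  haveI : IsFractionRing Γ(Y, V) Y.functionField :=
    functionField_isFractionRing_of_isAffineOpen Y V hV
  haveI : IsFractionRing Γ(Y, V) X.functionField :=
    IsLocalization.isLocalization_of_algEquiv (nonZeroDivisors Γ(Y, V)) eA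
  -- `A` is integrally closed, `A → B` integral and injective, hence bijective
  haveI : IsIntegrallyClosed Γ(Y, V) := hic
  have hint : (f.app V).hom.IsIntegral := f.isIntegral_app V hV
  have hinj : Function.Injective (f.app V) := f.app_injective V
  have hsurj : Function.Surjective (f.app V) := fun b => by
    have hb : IsIntegral Γ(Y, V) (algebraMap Γ(X, f ⁻¹ᵁ V) X.functionField b) :=
      (show IsIntegral Γ(Y, V) b from hint b).map
        (IsScalarTower.toAlgHom Γ(Y, V) Γ(X, f ⁻¹ᵁ V) X.functionField)
    obtain ⟨a, ha⟩ := IsIntegrallyClosed.algebraMap_eq_of_integral hb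
    refine ⟨a, X.germToFunctionField_injective (f ⁻¹ᵁ V) ?_⟩
    rw [IsScalarTower.algebraMap_apply Γ(Y, V) Γ(X, f ⁻¹ᵁ V) X.functionField] at ha
    exact ha
  haveI : IsIso (f.app V) := (ConcreteCategory.isIso_iff_bijective _).mpr ⟨hinj, hsurj⟩
  exact isIso_morphismRestrict_of_isIso_app f hV

/-- **A finite (integral) dominant morphism of integral schemes onto a variety whose stalk map at
the generic point is surjective is birational.** The stalk map `K(H) = 𝒪_{H,φ(η)} → K(X)` is then
an isomorphism (a ring map out of a field is injective); `H`, locally of finite type over the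
field `k`, has a non-empty affine open `W` with integrally closed coordinate ring (finiteness of
normalisation, `exists_isAffineOpen_isIntegrallyClosed`); over it `φ` is an isomorphism
(`isIso_morphismRestrict_of_isIntegrallyClosed`), and `W`, `φ⁻¹W` are dense, being non-empty opens
of irreducible spaces. [folklore; cite: StacksProject, Tag 0AB1] -/
theorem isBirational_of_surjective_stalkMap {X H : Scheme.{u}} [IsIntegral X] [IsIntegral H]
    (φ : X ⟶ H) [IsIntegralHom φ] [IsDominant φ] {k : Type u} [Field k]
    (g : H ⟶ Spec (.of k)) [LocallyOfFiniteType g]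
    (hφ : Function.Surjective (φ.stalkMap (genericPoint X))) : IsBirational φ := by
  have hη : φ (genericPoint X) = genericPoint H := genericPoint_eq_of_isDominant φ
  have hF : IsField (H.presheaf.stalk (φ (genericPoint X))) := by
    rw [hη]
    exact Field.toIsField H.functionField
  have hinj : Function.Injective (φ.stalkMap (genericPoint X)) := by
    letI := hF.toField
    exact (φ.stalkMap (genericPoint X)).hom.injective
  have hstalk : IsIso (φ.stalkMap (genericPoint X)) :=
    (ConcreteCategory.isIso_iff_bijective _).mpr ⟨hinj, hφ⟩
  obtain ⟨W, hW, hWne, hic⟩ :=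
    exists_isAffineOpen_isIntegrallyClosed H NoetherFiniteIntegralClosure_holds g
  refine ⟨W, W.2.dense hWne, ?_, isIso_morphismRestrict_of_isIntegrallyClosed φ hstalk hW hWne hic⟩
  refine (φ ⁻¹ᵁ W).2.dense ?_
  obtain ⟨y, hy⟩ := φ.denseRange.exists_mem_open W.2 hWne
  exact ⟨y, hy⟩


/-! # Part C: assembly -/

section Assembly

variable (d : ℕ) (k : Type u) [Field k]

attribute [local instance] isOpenImmersion_chartToPunctured

/-- The projection from the vertex `ℙ^{d+1} ∖ {vertex} → ℙ^d` is an affine morphism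
(`pr⁻¹ D₊(y_i) = D₊(x_i)`). [folklore] -/
theorem isAffineHom_vertexProjection : IsAffineHom (DeJong1996.vertexProjection d k) := by
  refine HasAffineProperty.of_iSup_eq_top (P := @IsAffineHom)
    (fun i : Fin (d + 1) => ⟨Proj.basicOpen (grading (Fin (d + 1)) k) (MvPolynomial.X i),
      Proj.isAffineOpen_basicOpen _ _ (X_mem k i) one_pos⟩) ?_ fun i => ?_
  · exact Proj.iSup_basicOpen_eq_top (grading (Fin (d + 1)) k) _
      (ProjectiveSpace.irrelevant_le_span d k)
  · have : IsAffineOpen (DeJong1996.vertexProjection d k ⁻¹ᵁ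
        Proj.basicOpen (grading (Fin (d + 1)) k) (MvPolynomial.X i)) := by
      rw [DeJong1996.vertexProjection_preimage_basicOpen, ← opensRange_chartToPunctured]
      exact isAffineOpen_opensRange _
    exact this

/-- The punctured space `ℙ^{d+1} ∖ {vertex}` is quasi-compact (a finite union of affine charts).
[folklore] -/
theorem compactSpace_puncturedSpace : CompactSpace ↥(DeJong1996.puncturedSpace d k) := by
  refine ⟨?_⟩
  have h : (Set.univ : Set ↥(DeJong1996.puncturedSpace d k)) =
      ⋃ i : Fin (d + 1), Set.range (DeJong1996.chartToPunctured d k i) := by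
    refine Set.eq_univ_of_forall (fun y => ?_) |>.symm
    obtain ⟨i, hi⟩ := exists_mem_opensRange_chartToPunctured d k y
    exact Set.mem_iUnion.2 ⟨i, hi⟩
  rw [h]
  exact isCompact_iUnion fun i => isCompact_range (DeJong1996.chartToPunctured d k i).continuous

/-- The structure morphism `ℙⁿ_k → Spec k` is smooth, separated and proper (tree:
`ProjectiveSpace.smoothOfRelativeDimension_projToSpec`, `ProjSpace.isProper_over`). [folklore] -/
theorem smooth_isSeparated_isProper_toSpec (n : ℕ) :
    Smooth (toSpec (Fin (n + 1)) k) ∧ IsSeparated (toSpec (Fin (n + 1)) k) ∧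
      IsProper (toSpec (Fin (n + 1)) k) := by
  refine ⟨?_, ?_, ?_⟩
  · haveI := ProjectiveSpace.smoothOfRelativeDimension_projToSpec n k
    exact SmoothOfRelativeDimension.smooth n (ProjBaseChange.projToSpec (Fin (n + 1)) k)
  · unfold Segre.toSpec; infer_instance
  · exact ProjSpace.isProper_over n k

/-- **Hypersurface models from a finite projection (the geometric half of stub 5).** Let `X` be an
integral scheme of dimension `d` and `φ₀ : X → ℙ^{d+1}_k` a finite morphism avoiding the vertex
`(0 : … : 0 : 1)` whose stalk map `𝒪_{ℙ^{d+1}, φ₀(η)} → K(X)` at the generic point is surjective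
(i.e. `φ₀` is birational onto its image). Then with `Y = ℙ^{d+1} ∖ {vertex}` — smooth, separated
and quasi-compact over `k` —, `H ⊆ Y` the scheme-theoretic image of `X` (integral, with LOCALLY
PRINCIPAL ideal, `exists_ker_ideal_isPrincipal`: `X → ℙ^d` is finite, being proper and affine, and
surjective by dimension) and `φ : X → H` the induced morphism (finite; birational by
`isBirational_of_surjective_stalkMap`), all requirements of `stub_hypersurfaceModel` are met.
[cite: Hartshorne1977, I Prop. 4.9; Kollar2007, Prop. 2.48 (proof)] -/
theorem hypersurfaceModel_of_projection {X : Scheme.{u}} [IsIntegral X]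
    (φ₀ : X ⟶ Proj (grading (Fin (d + 1 + 1)) k)) [IsFinite φ₀]
    (hv : ∀ x : X, φ₀ x ≠ DeJong1996.vertex d k) (hdim : topologicalKrullDim X = d)
    (hgen : Function.Surjective (φ₀.stalkMap (genericPoint X))) :
    ∃ (Y H : Scheme.{u}) (g : Y ⟶ Spec (.of k)) (j : H ⟶ Y) (φ : X ⟶ H),
      Smooth g ∧ IsSeparated g ∧ QuasiCompact g ∧ IsClosedImmersion j ∧ IsIntegral H ∧
      (∀ y : Y, ∃ U : Y.affineOpens, y ∈ (U : Y.Opens) ∧ (j.ker.ideal U).IsPrincipal) ∧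
      IsFinite φ ∧ IsBirational φ := by
  set Y : Scheme.{u} := ↑(DeJong1996.puncturedSpace d k) with hY
  -- `φ₀` factors through the punctured space
  obtain ⟨φY, hφY⟩ : ∃ φY : X ⟶ Y, φY ≫ (DeJong1996.puncturedSpace d k).ι = φ₀ :=
    ⟨IsOpenImmersion.lift (DeJong1996.puncturedSpace d k).ι φ₀ (by
      rintro _ ⟨x, rfl⟩
      rw [Scheme.Opens.range_ι, DeJong1996.coe_puncturedSpace]
      exact hv x), IsOpenImmersion.lift_fac _ _ _⟩
  subst hφY
  haveI : IsFinite φY := IsFinite.of_comp φY (DeJong1996.puncturedSpace d k).ι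
  -- `ψ = pr ∘ φ : X → ℙ^d` is finite (proper and affine) and surjective (dimension)
  obtain ⟨hsm, hsep, hpr⟩ := smooth_isSeparated_isProper_toSpec k (d + 1)
  obtain ⟨-, hsep', -⟩ := smooth_isSeparated_isProper_toSpec k d
  haveI := hsm; haveI := hsep; haveI := hpr; haveI := hsep'
  haveI := isAffineHom_vertexProjection d k
  haveI : IsAffineHom (φY ≫ DeJong1996.vertexProjection d k) := inferInstance
  have hover : (φY ≫ DeJong1996.vertexProjection d k) ≫ toSpec (Fin (d + 1)) k =
      (φY ≫ (DeJong1996.puncturedSpace d k).ι) ≫ toSpec (Fin (d + 1 + 1)) k := by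
    rw [Category.assoc, Category.assoc, DeJong1996.vertexProjection_toSpec]
  haveI : IsProper ((φY ≫ DeJong1996.vertexProjection d k) ≫ toSpec (Fin (d + 1)) k) := by
    rw [hover]; infer_instance
  haveI : IsProper (φY ≫ DeJong1996.vertexProjection d k) :=
    IsProper.of_comp (φY ≫ DeJong1996.vertexProjection d k) (toSpec (Fin (d + 1)) k)
  haveI : IsFinite (φY ≫ DeJong1996.vertexProjection d k) :=
    IsFinite.iff_isProper_and_isAffineHom.2 ⟨inferInstance, inferInstance⟩
  haveI : Surjective (φY ≫ DeJong1996.vertexProjection d k) :=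
    surjective_of_isFinite_of_dim (φY ≫ DeJong1996.vertexProjection d k) hdim
  -- the model
  haveI : IsIntegral φY.image := ChowLemmaProof.isIntegral_image φY
  haveI : CompactSpace Y := compactSpace_puncturedSpace d k
  refine ⟨Y, φY.image, (DeJong1996.puncturedSpace d k).ι ≫ toSpec (Fin (d + 1 + 1)) k, φY.imageι,
    φY.toImage, inferInstance, inferInstance, ?_, inferInstance, inferInstance, ?_, ?_, ?_⟩
  · exact (HasAffineProperty.iff_of_isAffine (P := @QuasiCompact)).mpr ‹CompactSpace Y›
  · intro y
    rw [Scheme.IdealSheafData.ker_subschemeι]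
    exact exists_ker_ideal_isPrincipal d k φY y
  · haveI : IsFinite (φY.toImage ≫ φY.imageι) := by rw [φY.toImage_imageι]; infer_instance
    exact IsFinite.of_comp φY.toImage φY.imageι
  · have h1 : Function.Surjective (φY.stalkMap (genericPoint X)) := by
      rw [Scheme.Hom.stalkMap_comp] at hgen
      exact Function.Surjective.of_comp hgen
    have h2 : Function.Surjective ((φY.toImage ≫ φY.imageι).stalkMap (genericPoint X)) := by
      rw [φY.toImage_imageι]; exact h1
    rw [Scheme.Hom.stalkMap_comp] at h2
    haveI : IsFinite (φY.toImage ≫ φY.imageι) := by rw [φY.toImage_imageι]; infer_instance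
    haveI : IsFinite φY.toImage := IsFinite.of_comp φY.toImage φY.imageι
    exact isBirational_of_surjective_stalkMap φY.toImage
      (φY.imageι ≫ (DeJong1996.puncturedSpace d k).ι ≫ toSpec (Fin (d + 1 + 1)) k)
      (Function.Surjective.of_comp h2)

end Assembly

/-! # Part D: from linear forms generating the function field -/

section LinearForms

variable (k : Type u) [Field k]

open Literature.AlgebraicGeometry.Morphisms.ProjCech (PP)

/-- A `k`-morphism is compatible with the constants on stalks: for `g : X → P` over `Spec k`,
the stalk map at `x` sends the germ of the constant `c` at `g(x)` to the germ of `c` at `x`.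
[folklore] -/
theorem stalkMap_germ_const {X P : Scheme.{u}} (g : X ⟶ P) (pP : P ⟶ Spec (.of k))
    (fX : X ⟶ Spec (.of k)) (h : g ≫ pP = fX) (x : X) (c : k) :
    (g.stalkMap x).hom ((P.presheaf.germ ⊤ (g x) trivial).hom
        (pP.appTop ((Scheme.ΓSpecIso (.of k)).inv c))) =
      (X.presheaf.germ ⊤ x trivial).hom (fX.appTop ((Scheme.ΓSpecIso (.of k)).inv c)) := by
  subst h
  rw [Scheme.Hom.germ_stalkMap_apply]
  rfl

omit [Field k] in
/-- The image of the stalk map at the generic point of an integral scheme is closed under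
inverses (a local homomorphism out of a local ring into a field kills the maximal ideal).
[folklore] -/
theorem inv_mem_range_stalkMap {X P : Scheme.{u}} [IsIntegral X] (g : X ⟶ P)
    {r : X.functionField} (hr : r ∈ Set.range (g.stalkMap (genericPoint X)).hom) :
    r⁻¹ ∈ Set.range (g.stalkMap (genericPoint X)).hom := by
  set F := (g.stalkMap (genericPoint X)).hom with hF
  obtain ⟨a, rfl⟩ := hr
  by_cases ha : F a = 0
  · exact ⟨0, by rw [ha, inv_zero, map_zero]⟩
  · have hu : IsUnit a := by
      by_contra hna
      apply ha
      have hFa : ¬IsUnit (F a) := fun hFa => hna ((isUnit_map_iff F a).mp hFa)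
      rwa [isUnit_iff_ne_zero, not_not] at hFa
    obtain ⟨u, rfl⟩ := hu
    exact ⟨↑u⁻¹, eq_inv_of_mul_eq_one_left (by rw [← map_mul, Units.inv_mul, map_one])⟩

/-- **Hypersurface models from linear forms generating the function field.** Let `X ⊆ ℙⁿ_k` be
an integral closed subscheme of dimension `d` and `t₀, …, t_{d+1}` linear forms such that
`t₀, …, t_d` have no common zero on `X`, `t₀ ≢ 0` on `X`, and the rational functions
`t₁/t₀, …, t_{d+1}/t₀` generate the function field `K(X)` over `k`. Then the linear projection
`π_t = (t₀ : … : t_{d+1}) : X → ℙ^{d+1}` (`LinSec.proj`: finite, avoiding the vertex) is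
surjective on the stalk at the generic point (`π_t^*(y_a/y₀) = t_a/t₀`,
`LinSec.stalkMap_proj_germ_sec`, and constants go to constants), so
`hypersurfaceModel_of_projection` applies: `X` has a hypersurface model.
[cite: Hartshorne1977, I Prop. 4.9; Kollar2007, Prop. 2.48 (proof)] -/
theorem hypersurfaceModel_of_linearForms (n : ℕ) {X : Scheme.{u}} [IsIntegral X] (ι : X ⟶ PP k n)
    [IsClosedImmersion ι] (d : ℕ) (t : Fin (d + 1 + 1) → Fin (n + 1) → k)
    (hbpf : LinSec.NoCommonZero ι (LinSec.tInit t)) (ht0 : LinSec.formFn ι (t 0) ≠ 0)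
    (hdim : topologicalKrullDim X = d)
    (hgen : Subfield.closure
        (Set.range ((X.presheaf.germ ⊤ (genericPoint X) trivial).hom.comp
            ((ι ≫ toSpec (Fin (n + 1)) k).appTop.hom.comp (Scheme.ΓSpecIso (.of k)).inv.hom)) ∪
          Set.range (fun a : Fin (d + 1) => LinSec.formFn ι (t a.succ) / LinSec.formFn ι (t 0))) = ⊤) :
    ∃ (Y H : Scheme.{u}) (g : Y ⟶ Spec (.of k)) (j : H ⟶ Y) (φ : X ⟶ H),
      Smooth g ∧ IsSeparated g ∧ QuasiCompact g ∧ IsClosedImmersion j ∧ IsIntegral H ∧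
      (∀ y : Y, ∃ U : Y.affineOpens, y ∈ (U : Y.Opens) ∧ (j.ker.ideal U).IsPrincipal) ∧
      IsFinite φ ∧ IsBirational φ := by
  obtain ⟨-, -, hpr⟩ := smooth_isSeparated_isProper_toSpec k n
  haveI := hpr
  set f : X ⟶ Spec (.of k) := ι ≫ toSpec (Fin (n + 1)) k with hf
  haveI : IsProper f := inferInstance
  have hbpf' : LinSec.NoCommonZero ι t :=
    ⟨fun x => let ⟨i, hi⟩ := hbpf.exists_notMem x; ⟨Fin.castSucc i, hi⟩⟩
  set φ₀ := LinSec.proj ι t f hbpf' with hφ₀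
  haveI : IsFinite φ₀ := LinSec.isFinite_proj ι t f hbpf'
  have hv : ∀ x : X, φ₀ x ≠ DeJong1996.vertex d k := fun x hx => by
    rw [hφ₀, LinSec.proj_eq_vertex_iff] at hx
    obtain ⟨i, hi⟩ := hbpf.exists_notMem x
    exact hi (Set.mem_iInter.1 hx i)
  refine hypersurfaceModel_of_projection d k φ₀ hv hdim ?_
  -- the image of the stalk map at the generic point is a subfield containing the generators
  set F := (φ₀.stalkMap (genericPoint X)).hom with hF
  let S : Subfield X.functionField :=
    { F.range with
      inv_mem' := fun r hr => inv_mem_range_stalkMap φ₀ hr }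
  have hS : (⊤ : Subfield X.functionField) ≤ S := by
    rw [← hgen, Subfield.closure_le]
    rintro r (⟨c, rfl⟩ | ⟨a, rfl⟩)
    · -- constants
      refine ⟨((PP k (d + 1)).presheaf.germ ⊤ (φ₀ (genericPoint X)) trivial).hom
        ((toSpec (Fin (d + 1 + 1)) k).appTop ((Scheme.ΓSpecIso (.of k)).inv c)), ?_⟩
      exact stalkMap_germ_const k φ₀ (toSpec (Fin (d + 1 + 1)) k) f (LinSec.proj_toSpec ι t f hbpf') _ c
    · -- the ratios `t_a / t_0`
      have h0 : LinSec.formVec ι t 0 ≠ 0 := ht0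
      have hxU : genericPoint X ∈ lsChart (LinSec.formVec ι t) 0 := genericPoint_mem_lsChart _ h0
      have hη0 : genericPoint X ∉ LinSec.hyp ι (t 0) := by
        rw [← LinSec.isUnitAt_formFn_div_iff ι (LinSec.genericPoint_mem_chart_j₀ ι)]
        exact RatFn.isUnitAt_genericPoint (div_ne_zero ht0
          (LinSec.formFn_single_ne_zero ι (LinSec.genericPoint_mem_chart_j₀ ι)))
      have hxP : φ₀ (genericPoint X) ∈ (ProjSpace.U 0 : (ProjSpace.P (d + 1) k).Opens) :=
        (LinSec.proj_apply_mem_basicOpen_iff ι t f hbpf' _ 0).2 hη0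
      refine ⟨((ProjSpace.P (d + 1) k).presheaf.germ (ProjSpace.U 0) _ hxP).hom
        (ProjSpace.sec 0 (Segre.frac k 0 a.succ)), ?_⟩
      exact (LinSec.stalkMap_proj_germ_sec ι t f hbpf' 0 hxP hxU a.succ).trans
        (ofSection_lsRatio (LinSec.formVec ι t) h0 a.succ)
  intro r
  obtain ⟨a, ha⟩ := hS (Subfield.mem_top r)
  exact ⟨a, ha⟩

end LinearForms

/-! # Part E: the registered shapes (universe `0`) and the glue of the proposed split -/

/-- **S5b (PROVED) — hypersurface models from linear projection data**, in the registered shape: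
for an integral closed `X ⊆ ℙⁿ_k` of dimension `d` over ANY field `k` and linear forms
`t₀, …, t_{d+1}` with `t₀, …, t_d` without common zero on `X`, `t₀ ≢ 0` on `X` and
`K(X) = k(t₁/t₀, …, t_{d+1}/t₀)`, the conclusion of `stub_hypersurfaceModel` holds
(`hypersurfaceModel_of_linearForms`). [cite: Hartshorne1977, I Prop. 4.9; Kollar2007, Prop. 2.48 (proof)] -/
theorem stub_hypersurfaceModel_of_linearForms : ∀ (k : Type) [Field k] (n : ℕ) (X : AlgebraicGeometry.Scheme.{0}) (ι : X ⟶ (Literature.AlgebraicGeometry.Motives.projectiveSpace n k).left) [AlgebraicGeometry.IsClosedImmersion ι] [AlgebraicGeometry.IsIntegral X] (d : ℕ) (t : Fin (d + 1 + 1) → Fin (n + 1) → k), Literature.AlgebraicGeometry.Resolution.LinSec.NoCommonZero ι (Literature.AlgebraicGeometry.Resolution.LinSec.tInit t) → Literature.AlgebraicGeometry.Resolution.LinSec.formFn ι (t 0) ≠ 0 → topologicalKrullDim X = d → Subfield.closure (Set.range ((X.presheaf.germ ⊤ (genericPoint X) trivial).hom.comp ((ι ≫ (Literature.AlgebraicGeometry.Motives.projectiveSpace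 n k).hom).appTop.hom.comp (AlgebraicGeometry.Scheme.ΓSpecIso (.of k)).inv.hom)) ∪ Set.range (fun a : Fin (d + 1) => Literature.AlgebraicGeometry.Resolution.LinSec.formFn ι (t a.succ) / Literature.AlgebraicGeometry.Resolution.LinSec.formFn ι (t 0))) = ⊤ → ∃ (Y H : AlgebraicGeometry.Scheme.{0}) (g : Y ⟶ AlgebraicGeometry.Spec (.of k)) (j : H ⟶ Y) (φ : X ⟶ H), AlgebraicGeometry.Smooth g ∧ AlgebraicGeometry.IsSeparated g ∧ AlgebraicGeometry.QuasiCompact g ∧ AlgebraicGeometry.IsClosedImmersion j ∧ AlgebraicGeometry.IsIntegral H ∧ (∀ y : Y, ∃ U : Y.affineOpens, y ∈ (U : Y.Opens) ∧ (j.ker.ideal U).IsPrincipal) ∧ AlgebraicGeometry.IsFinite φ ∧ Literature.AlgebraicGeometry.Resolution.IsBirational φ := by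
  intro k _ n X ι hι hX d t hbpf ht0 hdim hgen
  exact @hypersurfaceModel_of_linearForms k _ n X hX ι hι d t hbpf ht0 hdim hgen



end Summit.ResolutionOfSingularities.ResolutionOfSingularities.Theorems.WeightedThesis.HypersurfaceModel

end
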